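import Summits.Schanuel.Schanuel.Theorems.DiophantineDichotomyApproximationPropertyOrbitClusterBoundLemmas

/-!
# Clean cluster lever, I: Newton divided differences of the Vandermonde determinant

Crux `stmt-Schanuel-6117` (`Summit.Schanuel.Schanuel.Theses.DiophantineDichotomy.ApproximationProperty`),
line `orbit-interpolation-determinant`; lemmas file for the registered stub `cleanClusterLever`
(proved in `DiophantineDichotomyApproximationPropertyCleanClusterLever.lean`, which imports this file).
Its last theorem is the registered auxiliary stub `cleanClusterLever_vandermonde`. Everything here is
PROVED; no definitions, no named facts. Pure linear algebra over `ℂ`: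

* `CleanClusterLever.newton` — the Newton expansion of the monomial `z^j` at nodes `ζ₀, …, ζ_{k-1}`,
  `ζ_i^j = ∑_{m<k} E_m ∏_{l<m} (ζ_i - ζ_l)`, with the divided differences `E_m = z^j[ζ₀, …, ζ_m]`
  (`= h_{j-m}(ζ₀, …, ζ_m)`) produced by iterated synthetic division of coefficient sequences and
  bounded by `‖E_m‖ ≤ D^m ρ^j` (`ρ ≥ max(1, ‖ζ_l‖)`) — the mixed factors `ζ_i - ζ_l` are never expanded;
* `CleanClusterLever.norm_det_vandermonde_le` / `cleanClusterLever_vandermonde` — replacing the first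
  `k` rows of the `D × D` Vandermonde matrix by these divided differences is a lower-triangular row
  operation of determinant `∏_{l<i<k} (ζ_i - ζ_l)`, and the Leibniz bound
  (`norm_det_le_factorial_mul_prod`) on the eliminated matrix gives
  `‖V(ζ)‖ ≤ ∏_{l<i<k} ‖ζ_i - ζ_l‖ · D! · ∏_{i<k} D^i ρ^{D-1} · ∏_{i≥k} max(1, ‖ζ_i‖)^{D-1}`.

Sources: the card `orbit-interpolation-determinant` (one-dimensional cluster lever); divided
differences / Newton interpolation are folklore (e.g. de Boor, *A Practical Guide to Splines*, Ch. I).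
-/

set_option linter.dupNamespace false

namespace Summit.Schanuel.Schanuel.Cruxes.ApproximationProperty.OrbitInterpolationDeterminant

open Finset
open scoped BigOperators

namespace CleanClusterLever

/-! ## Newton divided differences of monomials (coefficient sequences) -/

/-- Synthetic division at the level of values: for a coefficient sequence `q` (length `D`),
`∑ q_c z^c = (z - a) · ∑_e (∑_{c>e} q_c a^{c-1-e}) z^e + ∑ q_c a^c`. [folklore] -/
theorem eval_eq_synthDiv (D : ℕ) (q : ℕ → ℂ) (a z : ℂ) :
    ∑ c ∈ range D, q c * z ^ c =
      (z - a) * ∑ e ∈ range D,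
          (∑ c ∈ range D, if e < c then q c * a ^ (c - 1 - e) else 0) * z ^ e +
        ∑ c ∈ range D, q c * a ^ c := by
  have hgeom : ∀ c : ℕ, z ^ c - a ^ c = (z - a) * ∑ i ∈ range c, a ^ (c - 1 - i) * z ^ i := by
    intro c
    rw [← geom_sum₂_mul z a c, mul_comm]
    exact congrArg _ (sum_congr rfl fun i _ => mul_comm _ _)
  have hinner : ∀ c ∈ range D,
      (∑ e ∈ range D, if e < c then q c * a ^ (c - 1 - e) * z ^ e else 0) =
        q c * ∑ i ∈ range c, a ^ (c - 1 - i) * z ^ i := by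
    intro c hc
    rw [← sum_filter, mul_sum]
    have hf : (range D).filter (· < c) = range c := by
      ext e; simp only [mem_filter, mem_range]; constructor
      · exact fun h => h.2
      · exact fun h => ⟨h.trans (mem_range.1 hc), h⟩
    rw [hf]
    exact sum_congr rfl fun e _ => by ring
  have hswap : ∑ e ∈ range D,
      (∑ c ∈ range D, if e < c then q c * a ^ (c - 1 - e) else 0) * z ^ e =
        ∑ c ∈ range D, q c * ∑ i ∈ range c, a ^ (c - 1 - i) * z ^ i := by
    rw [← sum_congr rfl hinner, sum_comm]
    refine sum_congr rfl fun e _ => ?_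
    rw [sum_mul]
    refine sum_congr rfl fun c _ => ?_
    split_ifs <;> simp
  rw [hswap, mul_sum, ← sum_add_distrib]
  exact sum_congr rfl fun c _ => by linear_combination (q c) * hgeom c

/-- The weighted `ℓ¹`-norm `∑ ‖q_c‖ ρ^c` (`ρ ≥ 1`, `‖a‖ ≤ ρ`) grows at most by the factor `D` under
synthetic division by `z - a`. [folklore] -/
theorem norm_synthDiv_le (D : ℕ) (q : ℕ → ℂ) (a : ℂ) (ρ : ℝ) (hρ : 1 ≤ ρ) (ha : ‖a‖ ≤ ρ) :
    ∑ e ∈ range D, ‖∑ c ∈ range D, (if e < c then q c * a ^ (c - 1 - e) else 0)‖ * ρ ^ e ≤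
      D * ∑ c ∈ range D, ‖q c‖ * ρ ^ c := by
  have hρ0 : 0 ≤ ρ := zero_le_one.trans hρ
  calc _ ≤ ∑ _e ∈ range D, ∑ c ∈ range D, ‖q c‖ * ρ ^ c := by
        refine sum_le_sum fun e _ => ?_
        calc ‖∑ c ∈ range D, (if e < c then q c * a ^ (c - 1 - e) else 0)‖ * ρ ^ e
            ≤ (∑ c ∈ range D, ‖(if e < c then q c * a ^ (c - 1 - e) else 0)‖) * ρ ^ e :=
              mul_le_mul_of_nonneg_right (norm_sum_le _ _) (pow_nonneg hρ0 _)
          _ = ∑ c ∈ range D, ‖(if e < c then q c * a ^ (c - 1 - e) else 0)‖ * ρ ^ e :=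
              sum_mul _ _ _
          _ ≤ _ := sum_le_sum fun c _ => ?_
        split_ifs with h
        · rw [norm_mul, norm_pow, mul_assoc]
          refine mul_le_mul_of_nonneg_left ?_ (norm_nonneg _)
          calc ‖a‖ ^ (c - 1 - e) * ρ ^ e ≤ ρ ^ (c - 1 - e) * ρ ^ e := by gcongr
            _ = ρ ^ (c - 1) := by rw [← pow_add]; congr 1; omega
            _ ≤ ρ ^ c := pow_le_pow_right₀ hρ (Nat.sub_le _ _)
        · rw [norm_zero, zero_mul]
          positivity
    _ = D * ∑ c ∈ range D, ‖q c‖ * ρ ^ c := by rw [sum_const, card_range, nsmul_eq_mul]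

/-- `‖∑ q_c a^c‖ ≤ ∑ ‖q_c‖ ρ^c` for `‖a‖ ≤ ρ`. [folklore] -/
theorem norm_eval_le (D : ℕ) (q : ℕ → ℂ) (a : ℂ) (ρ : ℝ) (ha : ‖a‖ ≤ ρ) :
    ‖∑ c ∈ range D, q c * a ^ c‖ ≤ ∑ c ∈ range D, ‖q c‖ * ρ ^ c :=
  (norm_sum_le _ _).trans (sum_le_sum fun c _ => by rw [norm_mul, norm_pow]; gcongr)

/-- **Newton expansion of a monomial with bounded divided differences** (induction invariant):
after `n` synthetic divisions by `z - ζ₀, …, z - ζₙ₋₁`,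
`z^j = ∑_{m<n} E_m ∏_{l<m} (z - ζ_l) + ∏_{l<n} (z - ζ_l) · q(z)` with `‖E_m‖ ≤ D^m ρ^j` and
`∑ ‖q_c‖ ρ^c ≤ Dⁿ ρ^j`. [folklore] -/
theorem newton_aux (D : ℕ) (ζ : ℕ → ℂ) (ρ : ℝ) (hρ : 1 ≤ ρ) (j : ℕ) (hj : j < D) :
    ∀ n : ℕ, (∀ l < n, ‖ζ l‖ ≤ ρ) → ∃ E q : ℕ → ℂ,
      (∀ z : ℂ, z ^ j = ∑ m ∈ range n, E m * ∏ l ∈ range m, (z - ζ l) +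
          (∏ l ∈ range n, (z - ζ l)) * ∑ c ∈ range D, q c * z ^ c) ∧
      (∑ c ∈ range D, ‖q c‖ * ρ ^ c ≤ (D : ℝ) ^ n * ρ ^ j) ∧
      ∀ m < n, ‖E m‖ ≤ (D : ℝ) ^ m * ρ ^ j := by
  intro n
  induction n with
  | zero =>
    intro _
    refine ⟨0, fun c => if c = j then 1 else 0, fun z => ?_, ?_, fun m hm => absurd hm m.not_lt_zero⟩
    · simp [Finset.sum_ite_eq', hj]
    · have h : ∀ c, ‖(if c = j then (1 : ℂ) else 0)‖ * ρ ^ c = if c = j then ρ ^ c else 0 := by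
        intro c; split_ifs <;> simp
      simp_rw [h]
      rw [Finset.sum_ite_eq', if_pos (mem_range.2 hj), pow_zero, one_mul]
  | succ n ih =>
    intro hζ
    obtain ⟨E, q, hid, hq, hE⟩ := ih fun l hl => hζ l (Nat.lt_succ_of_lt hl)
    have ha : ‖ζ n‖ ≤ ρ := hζ n n.lt_succ_self
    refine ⟨fun m => if m = n then ∑ c ∈ range D, q c * ζ n ^ c else E m,
      fun e => ∑ c ∈ range D, (if e < c then q c * ζ n ^ (c - 1 - e) else 0),
      fun z => ?_, ?_, ?_⟩
    · beta_reduce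
      rw [sum_range_succ, prod_range_succ, if_pos rfl]
      have h1 : ∑ m ∈ range n, (if m = n then ∑ c ∈ range D, q c * ζ n ^ c else E m) *
          ∏ l ∈ range m, (z - ζ l) = ∑ m ∈ range n, E m * ∏ l ∈ range m, (z - ζ l) :=
        sum_congr rfl fun m hm => by rw [if_neg (mem_range.1 hm).ne]
      rw [h1, hid z, eval_eq_synthDiv D q (ζ n) z]
      ring
    · calc _ ≤ D * ∑ c ∈ range D, ‖q c‖ * ρ ^ c := norm_synthDiv_le D q (ζ n) ρ hρ ha
        _ ≤ D * ((D : ℝ) ^ n * ρ ^ j) := by gcongr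
        _ = _ := by ring
    · intro m hm
      beta_reduce
      rcases Nat.lt_succ_iff_lt_or_eq.1 hm with hm | rfl
      · rw [if_neg hm.ne]; exact hE m hm
      · rw [if_pos rfl]; exact (norm_eval_le D q (ζ m) ρ ha).trans hq

/-- **Newton divided differences of the monomial `z^j` at the nodes `ζ₀, …, ζ_{k-1}`**:
coefficients `E_m` with `ζ_i^j = ∑_{m<k} E_m ∏_{l<m} (ζ_i - ζ_l)` for all `i < k` and
`‖E_m‖ ≤ D^m ρ^j` whenever `1 ≤ ρ` bounds the nodes (`E_m = h_{j-m}(ζ₀, …, ζ_m)`, never expanded).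
[folklore] -/
theorem newton (D k : ℕ) (ζ : ℕ → ℂ) (ρ : ℝ) (hρ : 1 ≤ ρ) (hζ : ∀ l < k, ‖ζ l‖ ≤ ρ)
    (j : ℕ) (hj : j < D) :
    ∃ E : ℕ → ℂ, (∀ i < k, ζ i ^ j = ∑ m ∈ range k, E m * ∏ l ∈ range m, (ζ i - ζ l)) ∧
      ∀ m < k, ‖E m‖ ≤ (D : ℝ) ^ m * ρ ^ j := by
  obtain ⟨E, q, hid, -, hE⟩ := newton_aux D ζ ρ hρ j hj k hζ
  refine ⟨E, fun i hi => ?_, hE⟩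
  rw [hid (ζ i), prod_eq_zero (mem_range.2 hi) (sub_self _), zero_mul, add_zero]

/-! ## The Vandermonde determinant after Newton elimination of the cluster rows -/

/-- **Divided-difference Vandermonde bound.** For nodes `ζ₀, …, ζ_{D-1}` whose first `k` have
`‖ζ_l‖ ≤ ρ` (`ρ ≥ 1`): replacing the first `k` rows of the Vandermonde matrix by their Newton
divided differences (a lower-triangular row operation of determinant `∏_{l<i<k} (ζ_i - ζ_l)⁻¹`)
and bounding the new determinant by Leibniz gives
`‖V‖ ≤ ∏_{l<i<k} ‖ζ_i - ζ_l‖ · D! · ∏_{i<k} (D^i ρ^{D-1}) · ∏_{i ≥ k} max(1, ‖ζ_i‖)^{D-1}`. [folklore] -/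
theorem norm_det_vandermonde_le (D k : ℕ) (hk : k ≤ D) (ζ : ℕ → ℂ) (ρ : ℝ) (hρ : 1 ≤ ρ)
    (hζ : ∀ l < k, ‖ζ l‖ ≤ ρ) :
    ‖(Matrix.vandermonde (fun i : Fin D => ζ i)).det‖ ≤
      (∏ i ∈ range k, ∏ l ∈ range i, ‖ζ i - ζ l‖) *
        ((D.factorial : ℝ) * ∏ i ∈ range D,
          (if i < k then (D : ℝ) ^ i * ρ ^ (D - 1) else max 1 ‖ζ i‖ ^ (D - 1))) := by
  classical
  have hN := fun j : Fin D => newton D k ζ ρ hρ hζ j.val j.isLt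
  choose E hEid hEbd using hN
  -- the eliminated matrix and the elimination matrix
  let W : Matrix (Fin D) (Fin D) ℂ :=
    Matrix.of fun m j => if (m : ℕ) < k then E j m else ζ m ^ (j : ℕ)
  let L : Matrix (Fin D) (Fin D) ℂ := Matrix.of fun i m =>
    if (i : ℕ) < k then (if (m : ℕ) < k then ∏ l ∈ range m, (ζ i - ζ l) else 0)
    else (if m = i then 1 else 0)
  have hLW : L * W = Matrix.vandermonde (fun i : Fin D => ζ i) := by
    ext i j
    rw [Matrix.mul_apply, Matrix.vandermonde_apply]
    by_cases hi : (i : ℕ) < k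
    · have h : ∀ m : Fin D, L i m * W m j =
          if (m : ℕ) < k then E j m * ∏ l ∈ range m, (ζ i - ζ l) else 0 := by
        intro m
        simp only [L, W, Matrix.of_apply, if_pos hi]
        split_ifs with hm <;> ring
      simp_rw [h]
      rw [Fin.sum_univ_eq_sum_range
        (fun m => if m < k then E j m * ∏ l ∈ range m, (ζ i - ζ l) else 0) D, ← sum_filter]
      have hf : (range D).filter (· < k) = range k := by
        ext m; simp only [mem_filter, mem_range]; omega
      rw [hf]
      exact (hEid j i hi).symm
    · have h : ∀ m : Fin D, L i m * W m j = if m = i then W i j else 0 := by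
        intro m
        simp only [L, Matrix.of_apply, if_neg hi]
        split_ifs with hm
        · subst hm; ring
        · ring
      simp_rw [h]
      rw [Finset.sum_ite_eq' univ i, if_pos (mem_univ _)]
      simp only [W, Matrix.of_apply, if_neg hi]
  have hLtri : L.BlockTriangular OrderDual.toDual := by
    intro i m him
    have him' : (i : ℕ) < m := Fin.lt_def.1 (OrderDual.toDual_lt_toDual.1 him)
    simp only [L, Matrix.of_apply]
    split_ifs with hi hm hm'
    · exact prod_eq_zero (mem_range.2 him') (sub_self _)
    · rfl
    · exact absurd (congrArg Fin.val hm') him'.ne'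
    · rfl
  have hdetL : ‖L.det‖ = ∏ i ∈ range k, ∏ l ∈ range i, ‖ζ i - ζ l‖ := by
    rw [Matrix.det_of_lowerTriangular L hLtri]
    have h : ∀ i : Fin D, L i i = if (i : ℕ) < k then ∏ l ∈ range i, (ζ i - ζ l) else 1 := by
      intro i
      simp only [L, Matrix.of_apply]
      split_ifs <;> rfl
    simp_rw [h]
    rw [Fin.prod_univ_eq_prod_range (fun i => if i < k then ∏ l ∈ range i, (ζ i - ζ l) else 1) D,
      ← prod_range_mul_prod_Ico _ hk, norm_mul]
    rw [prod_eq_one (s := Ico k D) fun i hi => by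
      rw [if_neg (not_lt.2 (mem_Ico.1 hi).1)], norm_one, mul_one, norm_prod]
    refine prod_congr rfl fun i hi => ?_
    rw [if_pos (mem_range.1 hi), norm_prod]
  -- Leibniz on `W`
  have hW : ‖W.det‖ ≤ (D.factorial : ℝ) * ∏ i ∈ range D,
      (if i < k then (D : ℝ) ^ i * ρ ^ (D - 1) else max 1 ‖ζ i‖ ^ (D - 1)) := by
    have h := norm_det_le_factorial_mul_prod W
      (fun a => if (a : ℕ) < k then (D : ℝ) ^ (a : ℕ) * ρ ^ (D - 1) else max 1 ‖ζ a‖ ^ (D - 1))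
      (fun a j => ?_)
    · rw [Fintype.card_fin] at h
      refine h.trans (le_of_eq ?_)
      rw [Fin.prod_univ_eq_prod_range
        (fun a => if a < k then (D : ℝ) ^ a * ρ ^ (D - 1) else max 1 ‖ζ a‖ ^ (D - 1)) D]
    · simp only [W, Matrix.of_apply]
      split_ifs with ha
      · calc ‖E j a‖ ≤ (D : ℝ) ^ (a : ℕ) * ρ ^ (j : ℕ) := hEbd j a ha
          _ ≤ (D : ℝ) ^ (a : ℕ) * ρ ^ (D - 1) :=
            mul_le_mul_of_nonneg_left (pow_le_pow_right₀ hρ (by have := j.isLt; omega))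
              (by positivity)
      · rw [norm_pow]
        calc ‖ζ a‖ ^ (j : ℕ) ≤ max 1 ‖ζ a‖ ^ (j : ℕ) :=
              pow_le_pow_left₀ (norm_nonneg _) (le_max_right _ _) _
          _ ≤ max 1 ‖ζ a‖ ^ (D - 1) :=
              pow_le_pow_right₀ (le_max_left _ _) (by have := j.isLt; omega)
  rw [← hLW, Matrix.det_mul, norm_mul, hdetL]
  exact mul_le_mul_of_nonneg_left hW (prod_nonneg fun i _ => prod_nonneg fun l _ => norm_nonneg _)

end CleanClusterLever

/-- **Divided-difference Vandermonde bound** (registered auxiliary stub `cleanClusterLever_vandermonde`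
of the line `orbit-interpolation-determinant`): for nodes `ζ₀, …, ζ_{D-1} ∈ ℂ` whose first `k` have
`‖ζ_l‖ ≤ ρ` (`ρ ≥ 1`),
`‖det V(ζ)‖ ≤ ∏_{l<i<k} ‖ζ_i - ζ_l‖ · (D! · ∏_i C_i)` with `C_i = D^i ρ^{D-1}` for `i < k` and
`C_i = max(1, ‖ζ_i‖)^{D-1}` for `i ≥ k`. [folklore] -/
theorem cleanClusterLever_vandermonde : ∀ (D k : ℕ), k ≤ D → ∀ (ζ : ℕ → ℂ) (ρ : ℝ), 1 ≤ ρ → (∀ l < k, ‖ζ l‖ ≤ ρ) → ‖(Matrix.vandermonde (fun i : Fin D => ζ i)).det‖ ≤ (∏ i ∈ Finset.range k, ∏ l ∈ Finset.range i, ‖ζ i - ζ l‖) * ((D.factorial : ℝ) * ∏ i ∈ Finset.range D, (if i < k then (D : ℝ) ^ i * ρ ^ (D - 1) else max 1 ‖ζ i‖ ^ (D - 1))) := by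
  intro D k hk ζ ρ hρ hζ
  exact CleanClusterLever.norm_det_vandermonde_le D k hk ζ ρ hρ hζ

end Summit.Schanuel.Schanuel.Cruxes.ApproximationProperty.OrbitInterpolationDeterminant
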